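import Summits.BirchSwinnertonDyer.BirchSwinnertonDyer.Theorems.KatoDescentPotSupersingularWildUpperUnitTwistRecordsSharpPImg07
import Summits.BirchSwinnertonDyer.BirchSwinnertonDyer.Theorems.KatoDescentPotSupersingularWildUpperUnitTwistRecordsSharpPImg08
import Summits.BirchSwinnertonDyer.BirchSwinnertonDyer.Theorems.KatoDescentPotSupersingularWildJetchevBoundAtPTwoSplit
import HarnessLib

/-!
# Route `KatoDescentPotSupersingular` (rung K9, sub-rung B5 = O6 wild `p = 3`, cell `bsd-potss`): NAMED-FACTS FORM of the ♯ₚ unit-twist records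
# — the displayed SCHEMA `hJp` REPLACED by the four named Literature facts BY NAME (the held aliases 23034–23037 of the K9 route) +
# Kolyvagin + newforms, on top of the Tamagawa and mod-3-image kernel upgrades (part 06: 457056bj1@3, 457056t1@3, 457056w1@3, 465696dn1@3, 477603j1@3, 487350q1@3, 496800cr1@3, 81675bq1@3)
# (seat `bsd-potss-k9-c4` g17; `--supports stmt-BirchSwinnertonDyer-19197 --as helper`)

HONEST FRAMING. THEOREMS ONLY (no definition, no named fact, no `sorry`); PER PAIR; nothing booked; items 19189 / 19197 / 21422 stay OPEN
class-wide; BSD is not proved for any class.  The ♯ₚ records (and their `_tam` / `_img` upgrades, this seat) display the reading schema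
`hJp`; k9-c4 g11 PROVED that schema from four named Literature facts — Matar–Nekovář 2019 Thm 0.7 (`hS1`), Gross 1991 Prop 3.7 (2) (`h37`),
Poitou–Tate for Selmer structures (`hPT`), Gross–Zagier III (3.1) image-free (`hF1`) — plus Kolyvagin (`hKo`) and modularity as newforms
(`hnf`): `JetchevIrreducibleSwapAtP.boundAtP_twoSplit_of_structureIrred_of_namedFacts`.  This file substitutes that proof per row (exactly as k8t-c4 g14's p598182 does for the KT ♯ records): `missingUpperBoundAt_g<label>_3_nf` =
the upgraded record (`_img` on Cartan rows, `_tam` on 9-deficient rows) with `hJp` DERIVED.  After this, a ♯ₚ record's displayed hypotheses are: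
the named facts BY NAME (`hGZ hKo hGZK hmod hS1 h37 hPT hF1 hnf` — published / cite-level HELD items), Cremona's `N`, `r_an = 0`, the
lattice-optimal datum with `3 ∤ c(D)`, the field, the twist numerics (+ `hns` on 9-deficient rows) — no schema, no Tamagawa datum, no image datum.
Import note: the derivation's module has the K9 (and KT) route file in its import cone, as p598182's does; the theorem used takes no route
declaration as a hypothesis.

References: [Jetchev2008] Conj. 1.3, Thm. 1.4, Cor. 1.5, Rem. 6.2; [MatarNekovar2019] Thm. 0.7, §0.11; [GrossLMS1991] Prop. 3.7 (2); [GrossZagier1986]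
I.6.3, III (3.1); [MilneADT2006] I Thm. 4.10; [KolyvaginEulerSystems1990] Thm. A; [Miller2011LMS] Def. 1.1; [Cremona2006] Table 1.
-/

set_option autoImplicit false
set_option linter.dupNamespace false
noncomputable section
open scoped Classical NumberField
open WeierstrassCurve NumberField Field
  Literature.NumberTheory.EllipticCurves
  Literature.NumberTheory.EllipticCurves.ModularForms Literature.NumberTheory.EllipticCurves.Rank1Residual
  Literature.NumberTheory.EllipticCurves.Rank1Residual.Typed Literature.NumberTheory.Automorphic
  Literature.NumberTheory.GaloisCohomology
  Summit.BirchSwinnertonDyer.Rank1Residual Summit.BirchSwinnertonDyer.Rank1Residual.Additive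
  Summit.BirchSwinnertonDyer.BirchSwinnertonDyer.Theorems

namespace Summit.BirchSwinnertonDyer.BirchSwinnertonDyer.Theorems.WildUpperUnitTwistRecords

/-- **RECORD `457056bj1` @ `3`, NAMED-FACTS FORM** — `missingUpperBoundAt_g457056bj1_3_img` with the schema `hJp` DERIVED from
`hS1 h37 hPT hF1 hKo hnf` (`JetchevIrreducibleSwapAtP.boundAtP_twoSplit_of_structureIrred_of_namedFacts`). Displayed: named facts by name, Cremona's `N`, `r_an = 0`,
the lattice-optimal datum with `3 ∤ c(D)`, the field, the twist numerics. Per pair; nothing booked; BSD is not proved by this.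
[cite: MatarNekovar2019, Thm. 0.7 (p. 456), §0.11 (p. 457)] [cite: GrossLMS1991, Prop. 3.7 (2)] [cite: GrossZagier1986, III (3.1)]
[cite: MilneADT2006, I Thm. 4.10] [cite: Jetchev2008, Cor. 1.5] [cite: Miller2011LMS, Def. 1.1] [cite: Cremona2006, Table 1 (Cremona label 457056bj1)] -/
theorem missingUpperBoundAt_g457056bj1_3_nf
    (hGZ : ∀ (N : ℕ) [NeZero N] (W : WeierstrassCurve ℚ) (K : Type) [Field K] [NumberField K],
      gross_zagier N W K)
    (hKo : ∀ (N : ℕ) [NeZero N] (W : WeierstrassCurve ℚ) (K : Type) [Field K] [NumberField K],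
      kolyvagin N W K)
    (hGZK : rank_eq_analyticRank_of_analyticRank_le_one) (hmod : hasEntireLFunction_rat)
    (hS1 : MatarNekovar2019.thm07_padicValNat_card_sha_primary_add_le_of_globalDivisibility_of_irreducible)
    (h37 : GrossLMS1991.prop37_2_frobeniusCongruence)
    (hPT : ∀ (K : Type) [Field K] [NumberField K], poitouTate_selmerStructure_duality_conj K)
    (hF1 : Gross1991_heegnerPoint_sub_ratTorsion_mem_E0_imageFree) (hnf : exists_isNewformOf)
    {W : WeierstrassCurve ℚ} [W.IsElliptic] [W.IsGloballyMinimal] (hWeq : W = (⟨0, 0, 0, (-114264), (-15768432)⟩ : WeierstrassCurve ℚ))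
    (hN : W.conductorNorm ℤ = 457056) (hr : W.analyticRank = 0)
    (D : ModularParametrizationData W 457056) (hopt : ∀ z ∈ D.L.lattice, ∃ w ∈ periodLattice D.f, z = (D.c : ℂ) * w)
    (hc : ¬ (3 : ℤ) ∣ D.c)
    (K : Type) [Field K] [NumberField K] (hK : IsImaginaryQuadratic K) (hdK : NumberField.discr K = -143)
    {Wd : WeierstrassCurve ℚ} [Wd.IsElliptic] [Wd.IsGloballyMinimal] (hWdeq : Wd = (⟨0, 0, 0, (-2336584536), 46110159233424⟩ : WeierstrassCurve ℚ))
    (hrd : Wd.analyticRank = 1) {qd : ℚ} (hqd : shaAn Wd = (qd : ℂ)) (hvd : padicValRat 3 qd ≤ 0) :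
    MissingUpperBoundAt W 3 :=
  missingUpperBoundAt_g457056bj1_3_img hGZ hKo hGZK hmod (JetchevIrreducibleSwapAtP.boundAtP_twoSplit_of_structureIrred_of_namedFacts hS1 h37 hPT hF1 hKo hnf) hWeq hN hr D hopt hc K hK hdK hWdeq hrd hqd hvd

/-- **RECORD `457056t1` @ `3`, NAMED-FACTS FORM** — `missingUpperBoundAt_g457056t1_3_img` with the schema `hJp` DERIVED from
`hS1 h37 hPT hF1 hKo hnf` (`JetchevIrreducibleSwapAtP.boundAtP_twoSplit_of_structureIrred_of_namedFacts`). Displayed: named facts by name, Cremona's `N`, `r_an = 0`,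
the lattice-optimal datum with `3 ∤ c(D)`, the field, the twist numerics. Per pair; nothing booked; BSD is not proved by this.
[cite: MatarNekovar2019, Thm. 0.7 (p. 456), §0.11 (p. 457)] [cite: GrossLMS1991, Prop. 3.7 (2)] [cite: GrossZagier1986, III (3.1)]
[cite: MilneADT2006, I Thm. 4.10] [cite: Jetchev2008, Cor. 1.5] [cite: Miller2011LMS, Def. 1.1] [cite: Cremona2006, Table 1 (Cremona label 457056t1)] -/
theorem missingUpperBoundAt_g457056t1_3_nf
    (hGZ : ∀ (N : ℕ) [NeZero N] (W : WeierstrassCurve ℚ) (K : Type) [Field K] [NumberField K],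
      gross_zagier N W K)
    (hKo : ∀ (N : ℕ) [NeZero N] (W : WeierstrassCurve ℚ) (K : Type) [Field K] [NumberField K],
      kolyvagin N W K)
    (hGZK : rank_eq_analyticRank_of_analyticRank_le_one) (hmod : hasEntireLFunction_rat)
    (hS1 : MatarNekovar2019.thm07_padicValNat_card_sha_primary_add_le_of_globalDivisibility_of_irreducible)
    (h37 : GrossLMS1991.prop37_2_frobeniusCongruence)
    (hPT : ∀ (K : Type) [Field K] [NumberField K], poitouTate_selmerStructure_duality_conj K)
    (hF1 : Gross1991_heegnerPoint_sub_ratTorsion_mem_E0_imageFree) (hnf : exists_isNewformOf)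
    {W : WeierstrassCurve ℚ} [W.IsElliptic] [W.IsGloballyMinimal] (hWeq : W = (⟨0, 0, 0, (-1014093), 386326584⟩ : WeierstrassCurve ℚ))
    (hN : W.conductorNorm ℤ = 457056) (hr : W.analyticRank = 0)
    (D : ModularParametrizationData W 457056) (hopt : ∀ z ∈ D.L.lattice, ∃ w ∈ periodLattice D.f, z = (D.c : ℂ) * w)
    (hc : ¬ (3 : ℤ) ∣ D.c)
    (K : Type) [Field K] [NumberField K] (hK : IsImaginaryQuadratic K) (hdK : NumberField.discr K = -143)
    {Wd : WeierstrassCurve ℚ} [Wd.IsElliptic] [Wd.IsGloballyMinimal] (hWdeq : Wd = (⟨0, 0, 0, (-20737187757), (-1129698901218888)⟩ : WeierstrassCurve ℚ))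
    (hrd : Wd.analyticRank = 1) {qd : ℚ} (hqd : shaAn Wd = (qd : ℂ)) (hvd : padicValRat 3 qd ≤ 0) :
    MissingUpperBoundAt W 3 :=
  missingUpperBoundAt_g457056t1_3_img hGZ hKo hGZK hmod (JetchevIrreducibleSwapAtP.boundAtP_twoSplit_of_structureIrred_of_namedFacts hS1 h37 hPT hF1 hKo hnf) hWeq hN hr D hopt hc K hK hdK hWdeq hrd hqd hvd

/-- **RECORD `457056w1` @ `3`, NAMED-FACTS FORM** — `missingUpperBoundAt_g457056w1_3_img` with the schema `hJp` DERIVED from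
`hS1 h37 hPT hF1 hKo hnf` (`JetchevIrreducibleSwapAtP.boundAtP_twoSplit_of_structureIrred_of_namedFacts`). Displayed: named facts by name, Cremona's `N`, `r_an = 0`,
the lattice-optimal datum with `3 ∤ c(D)`, the field, the twist numerics. Per pair; nothing booked; BSD is not proved by this.
[cite: MatarNekovar2019, Thm. 0.7 (p. 456), §0.11 (p. 457)] [cite: GrossLMS1991, Prop. 3.7 (2)] [cite: GrossZagier1986, III (3.1)]
[cite: MilneADT2006, I Thm. 4.10] [cite: Jetchev2008, Cor. 1.5] [cite: Miller2011LMS, Def. 1.1] [cite: Cremona2006, Table 1 (Cremona label 457056w1)] -/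
theorem missingUpperBoundAt_g457056w1_3_nf
    (hGZ : ∀ (N : ℕ) [NeZero N] (W : WeierstrassCurve ℚ) (K : Type) [Field K] [NumberField K],
      gross_zagier N W K)
    (hKo : ∀ (N : ℕ) [NeZero N] (W : WeierstrassCurve ℚ) (K : Type) [Field K] [NumberField K],
      kolyvagin N W K)
    (hGZK : rank_eq_analyticRank_of_analyticRank_le_one) (hmod : hasEntireLFunction_rat)
    (hS1 : MatarNekovar2019.thm07_padicValNat_card_sha_primary_add_le_of_globalDivisibility_of_irreducible)
    (h37 : GrossLMS1991.prop37_2_frobeniusCongruence)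
    (hPT : ∀ (K : Type) [Field K] [NumberField K], poitouTate_selmerStructure_duality_conj K)
    (hF1 : Gross1991_heegnerPoint_sub_ratTorsion_mem_E0_imageFree) (hnf : exists_isNewformOf)
    {W : WeierstrassCurve ℚ} [W.IsElliptic] [W.IsGloballyMinimal] (hWeq : W = (⟨0, 0, 0, (-14283), 1971054⟩ : WeierstrassCurve ℚ))
    (hN : W.conductorNorm ℤ = 457056) (hr : W.analyticRank = 0)
    (D : ModularParametrizationData W 457056) (hopt : ∀ z ∈ D.L.lattice, ∃ w ∈ periodLattice D.f, z = (D.c : ℂ) * w)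
    (hc : ¬ (3 : ℤ) ∣ D.c)
    (K : Type) [Field K] [NumberField K] (hK : IsImaginaryQuadratic K) (hdK : NumberField.discr K = -191)
    {Wd : WeierstrassCurve ℚ} [Wd.IsElliptic] [Wd.IsGloballyMinimal] (hWdeq : Wd = (⟨0, 0, 0, (-521058123), (-13734050006034)⟩ : WeierstrassCurve ℚ))
    (hrd : Wd.analyticRank = 1) {qd : ℚ} (hqd : shaAn Wd = (qd : ℂ)) (hvd : padicValRat 3 qd ≤ 0) :
    MissingUpperBoundAt W 3 :=
  missingUpperBoundAt_g457056w1_3_img hGZ hKo hGZK hmod (JetchevIrreducibleSwapAtP.boundAtP_twoSplit_of_structureIrred_of_namedFacts hS1 h37 hPT hF1 hKo hnf) hWeq hN hr D hopt hc K hK hdK hWdeq hrd hqd hvd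

/-- **RECORD `465696dn1` @ `3`, NAMED-FACTS FORM** — `missingUpperBoundAt_g465696dn1_3_img` with the schema `hJp` DERIVED from
`hS1 h37 hPT hF1 hKo hnf` (`JetchevIrreducibleSwapAtP.boundAtP_twoSplit_of_structureIrred_of_namedFacts`). Displayed: named facts by name, Cremona's `N`, `r_an = 0`,
the lattice-optimal datum with `3 ∤ c(D)`, the field, the twist numerics. Per pair; nothing booked; BSD is not proved by this.
[cite: MatarNekovar2019, Thm. 0.7 (p. 456), §0.11 (p. 457)] [cite: GrossLMS1991, Prop. 3.7 (2)] [cite: GrossZagier1986, III (3.1)]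
[cite: MilneADT2006, I Thm. 4.10] [cite: Jetchev2008, Cor. 1.5] [cite: Miller2011LMS, Def. 1.1] [cite: Cremona2006, Table 1 (Cremona label 465696dn1)] -/
theorem missingUpperBoundAt_g465696dn1_3_nf
    (hGZ : ∀ (N : ℕ) [NeZero N] (W : WeierstrassCurve ℚ) (K : Type) [Field K] [NumberField K],
      gross_zagier N W K)
    (hKo : ∀ (N : ℕ) [NeZero N] (W : WeierstrassCurve ℚ) (K : Type) [Field K] [NumberField K],
      kolyvagin N W K)
    (hGZK : rank_eq_analyticRank_of_analyticRank_le_one) (hmod : hasEntireLFunction_rat)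
    (hS1 : MatarNekovar2019.thm07_padicValNat_card_sha_primary_add_le_of_globalDivisibility_of_irreducible)
    (h37 : GrossLMS1991.prop37_2_frobeniusCongruence)
    (hPT : ∀ (K : Type) [Field K] [NumberField K], poitouTate_selmerStructure_duality_conj K)
    (hF1 : Gross1991_heegnerPoint_sub_ratTorsion_mem_E0_imageFree) (hnf : exists_isNewformOf)
    {W : WeierstrassCurve ℚ} [W.IsElliptic] [W.IsGloballyMinimal] (hWeq : W = (⟨0, 0, 0, (-195804), 33784128⟩ : WeierstrassCurve ℚ))
    (hN : W.conductorNorm ℤ = 465696) (hr : W.analyticRank = 0)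
    (D : ModularParametrizationData W 465696) (hopt : ∀ z ∈ D.L.lattice, ∃ w ∈ periodLattice D.f, z = (D.c : ℂ) * w)
    (hc : ¬ (3 : ℤ) ∣ D.c)
    (K : Type) [Field K] [NumberField K] (hK : IsImaginaryQuadratic K) (hdK : NumberField.discr K = -167)
    {Wd : WeierstrassCurve ℚ} [Wd.IsElliptic] [Wd.IsGloballyMinimal] (hWdeq : Wd = (⟨0, 0, 0, (-5460777756), (-157348326147264)⟩ : WeierstrassCurve ℚ))
    (hrd : Wd.analyticRank = 1) {qd : ℚ} (hqd : shaAn Wd = (qd : ℂ)) (hvd : padicValRat 3 qd ≤ 0) :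
    MissingUpperBoundAt W 3 :=
  missingUpperBoundAt_g465696dn1_3_img hGZ hKo hGZK hmod (JetchevIrreducibleSwapAtP.boundAtP_twoSplit_of_structureIrred_of_namedFacts hS1 h37 hPT hF1 hKo hnf) hWeq hN hr D hopt hc K hK hdK hWdeq hrd hqd hvd

/-- **RECORD `477603j1` @ `3`, NAMED-FACTS FORM** — `missingUpperBoundAt_g477603j1_3_img` with the schema `hJp` DERIVED from
`hS1 h37 hPT hF1 hKo hnf` (`JetchevIrreducibleSwapAtP.boundAtP_twoSplit_of_structureIrred_of_namedFacts`). Displayed: named facts by name, Cremona's `N`, `r_an = 0`,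
the lattice-optimal datum with `3 ∤ c(D)`, the field, the twist numerics. Per pair; nothing booked; BSD is not proved by this.
[cite: MatarNekovar2019, Thm. 0.7 (p. 456), §0.11 (p. 457)] [cite: GrossLMS1991, Prop. 3.7 (2)] [cite: GrossZagier1986, III (3.1)]
[cite: MilneADT2006, I Thm. 4.10] [cite: Jetchev2008, Cor. 1.5] [cite: Miller2011LMS, Def. 1.1] [cite: Cremona2006, Table 1 (Cremona label 477603j1)] -/
theorem missingUpperBoundAt_g477603j1_3_nf
    (hGZ : ∀ (N : ℕ) [NeZero N] (W : WeierstrassCurve ℚ) (K : Type) [Field K] [NumberField K],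
      gross_zagier N W K)
    (hKo : ∀ (N : ℕ) [NeZero N] (W : WeierstrassCurve ℚ) (K : Type) [Field K] [NumberField K],
      kolyvagin N W K)
    (hGZK : rank_eq_analyticRank_of_analyticRank_le_one) (hmod : hasEntireLFunction_rat)
    (hS1 : MatarNekovar2019.thm07_padicValNat_card_sha_primary_add_le_of_globalDivisibility_of_irreducible)
    (h37 : GrossLMS1991.prop37_2_frobeniusCongruence)
    (hPT : ∀ (K : Type) [Field K] [NumberField K], poitouTate_selmerStructure_duality_conj K)
    (hF1 : Gross1991_heegnerPoint_sub_ratTorsion_mem_E0_imageFree) (hnf : exists_isNewformOf)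
    {W : WeierstrassCurve ℚ} [W.IsElliptic] [W.IsGloballyMinimal] (hWeq : W = (⟨1, (-1), 1, 208951, (-291852746)⟩ : WeierstrassCurve ℚ))
    (hN : W.conductorNorm ℤ = 477603) (hr : W.analyticRank = 0)
    (D : ModularParametrizationData W 477603) (hopt : ∀ z ∈ D.L.lattice, ∃ w ∈ periodLattice D.f, z = (D.c : ℂ) * w)
    (hc : ¬ (3 : ℤ) ∣ D.c)
    (K : Type) [Field K] [NumberField K] (hK : IsImaginaryQuadratic K) (hdK : NumberField.discr K = -143)
    {Wd : WeierstrassCurve ℚ} [Wd.IsElliptic] [Wd.IsGloballyMinimal] (hWdeq : Wd = (⟨1, (-1), 1, 4272845389, 853284019611664⟩ : WeierstrassCurve ℚ))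
    (hrd : Wd.analyticRank = 1) {qd : ℚ} (hqd : shaAn Wd = (qd : ℂ)) (hvd : padicValRat 3 qd ≤ 0) :
    MissingUpperBoundAt W 3 :=
  missingUpperBoundAt_g477603j1_3_img hGZ hKo hGZK hmod (JetchevIrreducibleSwapAtP.boundAtP_twoSplit_of_structureIrred_of_namedFacts hS1 h37 hPT hF1 hKo hnf) hWeq hN hr D hopt hc K hK hdK hWdeq hrd hqd hvd

/-- **RECORD `487350q1` @ `3`, NAMED-FACTS FORM** — `missingUpperBoundAt_g487350q1_3_img` with the schema `hJp` DERIVED from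
`hS1 h37 hPT hF1 hKo hnf` (`JetchevIrreducibleSwapAtP.boundAtP_twoSplit_of_structureIrred_of_namedFacts`). Displayed: named facts by name, Cremona's `N`, `r_an = 0`,
the lattice-optimal datum with `3 ∤ c(D)`, the field, the twist numerics. Per pair; nothing booked; BSD is not proved by this.
[cite: MatarNekovar2019, Thm. 0.7 (p. 456), §0.11 (p. 457)] [cite: GrossLMS1991, Prop. 3.7 (2)] [cite: GrossZagier1986, III (3.1)]
[cite: MilneADT2006, I Thm. 4.10] [cite: Jetchev2008, Cor. 1.5] [cite: Miller2011LMS, Def. 1.1] [cite: Cremona2006, Table 1 (Cremona label 487350q1)] -/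
theorem missingUpperBoundAt_g487350q1_3_nf
    (hGZ : ∀ (N : ℕ) [NeZero N] (W : WeierstrassCurve ℚ) (K : Type) [Field K] [NumberField K],
      gross_zagier N W K)
    (hKo : ∀ (N : ℕ) [NeZero N] (W : WeierstrassCurve ℚ) (K : Type) [Field K] [NumberField K],
      kolyvagin N W K)
    (hGZK : rank_eq_analyticRank_of_analyticRank_le_one) (hmod : hasEntireLFunction_rat)
    (hS1 : MatarNekovar2019.thm07_padicValNat_card_sha_primary_add_le_of_globalDivisibility_of_irreducible)
    (h37 : GrossLMS1991.prop37_2_frobeniusCongruence)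
    (hPT : ∀ (K : Type) [Field K] [NumberField K], poitouTate_selmerStructure_duality_conj K)
    (hF1 : Gross1991_heegnerPoint_sub_ratTorsion_mem_E0_imageFree) (hnf : exists_isNewformOf)
    {W : WeierstrassCurve ℚ} [W.IsElliptic] [W.IsGloballyMinimal] (hWeq : W = (⟨1, (-1), 0, (-1426854192), 19988598185216⟩ : WeierstrassCurve ℚ))
    (hN : W.conductorNorm ℤ = 487350) (hr : W.analyticRank = 0)
    (D : ModularParametrizationData W 487350) (hopt : ∀ z ∈ D.L.lattice, ∃ w ∈ periodLattice D.f, z = (D.c : ℂ) * w)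
    (hc : ¬ (3 : ℤ) ∣ D.c)
    (K : Type) [Field K] [NumberField K] (hK : IsImaginaryQuadratic K) (hdK : NumberField.discr K = -599)
    {Wd : WeierstrassCurve ℚ} [Wd.IsElliptic] [Wd.IsGloballyMinimal] (hWdeq : Wd = (⟨1, (-1), 0, (-511956711011067), (-4295908687948109621659)⟩ : WeierstrassCurve ℚ))
    (hrd : Wd.analyticRank = 1) {qd : ℚ} (hqd : shaAn Wd = (qd : ℂ)) (hvd : padicValRat 3 qd ≤ 0) :
    MissingUpperBoundAt W 3 :=
  missingUpperBoundAt_g487350q1_3_img hGZ hKo hGZK hmod (JetchevIrreducibleSwapAtP.boundAtP_twoSplit_of_structureIrred_of_namedFacts hS1 h37 hPT hF1 hKo hnf) hWeq hN hr D hopt hc K hK hdK hWdeq hrd hqd hvd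

/-- **RECORD `496800cr1` @ `3`, NAMED-FACTS FORM** — `missingUpperBoundAt_g496800cr1_3_img` with the schema `hJp` DERIVED from
`hS1 h37 hPT hF1 hKo hnf` (`JetchevIrreducibleSwapAtP.boundAtP_twoSplit_of_structureIrred_of_namedFacts`). Displayed: named facts by name, Cremona's `N`, `r_an = 0`,
the lattice-optimal datum with `3 ∤ c(D)`, the field, the twist numerics. Per pair; nothing booked; BSD is not proved by this.
[cite: MatarNekovar2019, Thm. 0.7 (p. 456), §0.11 (p. 457)] [cite: GrossLMS1991, Prop. 3.7 (2)] [cite: GrossZagier1986, III (3.1)]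
[cite: MilneADT2006, I Thm. 4.10] [cite: Jetchev2008, Cor. 1.5] [cite: Miller2011LMS, Def. 1.1] [cite: Cremona2006, Table 1 (Cremona label 496800cr1)] -/
theorem missingUpperBoundAt_g496800cr1_3_nf
    (hGZ : ∀ (N : ℕ) [NeZero N] (W : WeierstrassCurve ℚ) (K : Type) [Field K] [NumberField K],
      gross_zagier N W K)
    (hKo : ∀ (N : ℕ) [NeZero N] (W : WeierstrassCurve ℚ) (K : Type) [Field K] [NumberField K],
      kolyvagin N W K)
    (hGZK : rank_eq_analyticRank_of_analyticRank_le_one) (hmod : hasEntireLFunction_rat)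
    (hS1 : MatarNekovar2019.thm07_padicValNat_card_sha_primary_add_le_of_globalDivisibility_of_irreducible)
    (h37 : GrossLMS1991.prop37_2_frobeniusCongruence)
    (hPT : ∀ (K : Type) [Field K] [NumberField K], poitouTate_selmerStructure_duality_conj K)
    (hF1 : Gross1991_heegnerPoint_sub_ratTorsion_mem_E0_imageFree) (hnf : exists_isNewformOf)
    {W : WeierstrassCurve ℚ} [W.IsElliptic] [W.IsGloballyMinimal] (hWeq : W = (⟨0, 0, 0, (-47925), 3969000⟩ : WeierstrassCurve ℚ))
    (hN : W.conductorNorm ℤ = 496800) (hr : W.analyticRank = 0)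
    (D : ModularParametrizationData W 496800) (hopt : ∀ z ∈ D.L.lattice, ∃ w ∈ periodLattice D.f, z = (D.c : ℂ) * w)
    (hc : ¬ (3 : ℤ) ∣ D.c)
    (K : Type) [Field K] [NumberField K] (hK : IsImaginaryQuadratic K) (hdK : NumberField.discr K = -191)
    {Wd : WeierstrassCurve ℚ} [Wd.IsElliptic] [Wd.IsGloballyMinimal] (hWdeq : Wd = (⟨0, 0, 0, (-1748351925), (-27655479999000)⟩ : WeierstrassCurve ℚ))
    (hrd : Wd.analyticRank = 1) {qd : ℚ} (hqd : shaAn Wd = (qd : ℂ)) (hvd : padicValRat 3 qd ≤ 0) :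
    MissingUpperBoundAt W 3 :=
  missingUpperBoundAt_g496800cr1_3_img hGZ hKo hGZK hmod (JetchevIrreducibleSwapAtP.boundAtP_twoSplit_of_structureIrred_of_namedFacts hS1 h37 hPT hF1 hKo hnf) hWeq hN hr D hopt hc K hK hdK hWdeq hrd hqd hvd

/-- **RECORD `81675bq1` @ `3`, NAMED-FACTS FORM** — `missingUpperBoundAt_g81675bq1_3_img` with the schema `hJp` DERIVED from
`hS1 h37 hPT hF1 hKo hnf` (`JetchevIrreducibleSwapAtP.boundAtP_twoSplit_of_structureIrred_of_namedFacts`). Displayed: named facts by name, Cremona's `N`, `r_an = 0`,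
the lattice-optimal datum with `3 ∤ c(D)`, the field, the twist numerics. Per pair; nothing booked; BSD is not proved by this.
[cite: MatarNekovar2019, Thm. 0.7 (p. 456), §0.11 (p. 457)] [cite: GrossLMS1991, Prop. 3.7 (2)] [cite: GrossZagier1986, III (3.1)]
[cite: MilneADT2006, I Thm. 4.10] [cite: Jetchev2008, Cor. 1.5] [cite: Miller2011LMS, Def. 1.1] [cite: Cremona2006, Table 1 (Cremona label 81675bq1)] -/
theorem missingUpperBoundAt_g81675bq1_3_nf
    (hGZ : ∀ (N : ℕ) [NeZero N] (W : WeierstrassCurve ℚ) (K : Type) [Field K] [NumberField K],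
      gross_zagier N W K)
    (hKo : ∀ (N : ℕ) [NeZero N] (W : WeierstrassCurve ℚ) (K : Type) [Field K] [NumberField K],
      kolyvagin N W K)
    (hGZK : rank_eq_analyticRank_of_analyticRank_le_one) (hmod : hasEntireLFunction_rat)
    (hS1 : MatarNekovar2019.thm07_padicValNat_card_sha_primary_add_le_of_globalDivisibility_of_irreducible)
    (h37 : GrossLMS1991.prop37_2_frobeniusCongruence)
    (hPT : ∀ (K : Type) [Field K] [NumberField K], poitouTate_selmerStructure_duality_conj K)
    (hF1 : Gross1991_heegnerPoint_sub_ratTorsion_mem_E0_imageFree) (hnf : exists_isNewformOf)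
    {W : WeierstrassCurve ℚ} [W.IsElliptic] [W.IsGloballyMinimal] (hWeq : W = (⟨0, 0, 1, (-3593700), (-2581848844)⟩ : WeierstrassCurve ℚ))
    (hN : W.conductorNorm ℤ = 81675) (hr : W.analyticRank = 0)
    (D : ModularParametrizationData W 81675) (hopt : ∀ z ∈ D.L.lattice, ∃ w ∈ periodLattice D.f, z = (D.c : ℂ) * w)
    (hc : ¬ (3 : ℤ) ∣ D.c)
    (K : Type) [Field K] [NumberField K] (hK : IsImaginaryQuadratic K) (hdK : NumberField.discr K = -239)
    {Wd : WeierstrassCurve ℚ} [Wd.IsElliptic] [Wd.IsGloballyMinimal] (hWdeq : Wd = (⟨0, 0, 1, (-205275737700), 35247191285118656⟩ : WeierstrassCurve ℚ))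
    (hrd : Wd.analyticRank = 1) {qd : ℚ} (hqd : shaAn Wd = (qd : ℂ)) (hvd : padicValRat 3 qd ≤ 0) :
    MissingUpperBoundAt W 3 :=
  missingUpperBoundAt_g81675bq1_3_img hGZ hKo hGZK hmod (JetchevIrreducibleSwapAtP.boundAtP_twoSplit_of_structureIrred_of_namedFacts hS1 h37 hPT hF1 hKo hnf) hWeq hN hr D hopt hc K hK hdK hWdeq hrd hqd hvd

end Summit.BirchSwinnertonDyer.BirchSwinnertonDyer.Theorems.WildUpperUnitTwistRecords

end
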